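import Summits.BirchSwinnertonDyer.BirchSwinnertonDyer.Theorems.PrintCf2SplitBadTwoStrictDefectSixModSixteen
import HarnessLib

/-!
# Crux `PrintCf2.SplitBadTwoRankOneOfFacts` (stmt-BirchSwinnertonDyer-20368), skeleton v13.1, stub S3d `stub_strictDefectAtVbar_two` — THE ASSEMBLY OVER THE
# CLASSES `[d]₂`: the registered stub's `∃ eδ` statement from its three remaining per-class instances (class (ii) `d ≡ 7 (8) ∪ d ≡ 6 (16)` is a theorem, p693541)

Cell `bsd-print-cf2`, width seat `bsd-line-cf2-p1-w6` g5 (S3d: «𝓗 local + ch(𝓗^∨)(0) per class + S3d assembly», LEAD 02:30:44Z ownership map); `--supports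
stmt-BirchSwinnertonDyer-20368 --as helper`. HONEST FRAMING: this file proves the registered stub's statement ONLY MODULO three displayed per-class hypotheses
(classes (iii)-odd, (iii)-even, (i)); it does not close the stub or the crux; no summit statement is proved by this seat; BSD is not proved by any of this.
No definition, no named fact, no `sorry`.

THE CLASS FUNCTION. `[d]₂` is keyed as in the stub by `(d % 2, (d / (2 − d % 2)) % 8)`; for `d` square-free with `d % 4 ≠ 1` the keys are `(1,3), (1,7)` (odd) and
`(0,1), (0,3), (0,5), (0,7)` (even, `d/2` odd). The defect is `e_δ = 2` on `(1,3)`, `1` on `(0,7)`, `0` elsewhere (LEAD v12/v13 docstring «2 + a on d ≡ 3 (8)»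
corrected per sub-class by scrit R113: `#(W*)^{D_v̄} = 4` on `d ≡ 3 (8)`, `= 2` on `d ≡ 14 (16)`; -w3 g12 receptacle p695516), i.e.
`eδ k₁ k₂ := if k₁ = 1 ∧ k₂ = 3 then 2 else if k₁ = 0 ∧ k₂ = 7 then 1 else 0`.
* **`strictDefectAtVbar_two_of_classes`** — `stub_strictDefectAtVbar_two`'s statement VERBATIM, from: (h13) its body with `(n' : ℤ) = n + 2` on `d % 8 = 3`;
  (h07) its body with `(n' : ℤ) = n + 1` on `2 ∣ d ∧ (d/2) % 8 = 7`; (h15) its body with `(n' : ℤ) = n + 0` on `2 ∣ d ∧ (d/2) % 4 = 1`; the class (ii)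
  (`d % 8 = 7 ∨ (2 ∣ d ∧ (d/2) % 8 = 3)`, `e = 0`) is the tree theorem `StrictDefect.strictDefectAtVbar_two_of_frame_classTwo` (p693541). The three hypotheses are
  exactly what -w3 g12's class-(iii) readers (H := W*, j := eval ∘ (DC-6), hcoinv = -w4 p695592, hne = -w7 p695439) and -w8 g4's class-(i) file deliver; the closing
  file instantiates them. Pure case analysis (`Squarefree d ⟹ 4 ∤ d ⟹ d/2` odd for even `d`).

presearch: none needed (assembly of tree statements); the class table is Greenberg–Vatsal 2000 §2 Cor. 2.3 / Prop. 2.4 in shape. beyond-print theorem: no.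

References: [GreenbergVatsal2000] §2 pp. 17–22; [Agboola2007] §3 Prop. 3.2, Thm. 3.1.
-/

noncomputable section

open scoped Classical

set_option linter.dupNamespace false
set_option autoImplicit false

open NumberField IsDedekindDomain Field WeierstrassCurve
open Literature.NumberTheory.EllipticCurves Literature.NumberTheory.EllipticCurves.GreenbergSelmer
open Literature.NumberTheory.EllipticCurves.GreenbergVatsal2000 Literature.NumberTheory.EllipticCurves.Castella2018
open Literature.NumberTheory.EllipticCurves.Agboola2007
open Literature.NumberTheory.GaloisRepresentations

namespace Summit.BirchSwinnertonDyer.BirchSwinnertonDyer.Theorems.PrintCf2.StrictDefect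

/-- An even square-free integer has odd half. [folklore] -/
theorem emod_two_ediv_two_of_squarefree {d : ℤ} (hsq : Squarefree d) (h2d : (2 : ℤ) ∣ d) : (d / 2) % 2 = 1 := by
  have h4 : ¬ (4 : ℤ) ∣ d := fun h ↦ by
    have hu := hsq 2 (by simpa [show (2 : ℤ) * 2 = 4 by norm_num] using h)
    rw [Int.isUnit_iff] at hu
    omega
  omega

/-- **S3d ASSEMBLED OVER THE CLASSES, MODULO THE THREE OPEN PER-CLASS INSTANCES.** The statement of `stub_strictDefectAtVbar_two` (skeleton v13.1, VERBATIM), with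
`eδ k₁ k₂ := if k₁ = 1 ∧ k₂ = 3 then 2 else if k₁ = 0 ∧ k₂ = 7 then 1 else 0`, from its body on `d % 8 = 3` with defect `2` (h13), on `d ≡ 14 (16)` with defect `1`
(h07), on `d ≡ 2, 10 (16)` with defect `0` (h15), and the THEOREM `strictDefectAtVbar_two_of_frame_classTwo` (defect `0` on `d ≡ 7 (8) ∪ d ≡ 6 (16)`).
[cite: GreenbergVatsal2000, §2 Cor. 2.3 and Prop. 2.4] [cite: Agboola2007, §3 Prop. 3.2 and Thm. 3.1] -/
theorem strictDefectAtVbar_two_of_classes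
    (h13 : ∀ (d : ℤ), d ≠ 0 → Squarefree d → d % 4 ≠ 1 → d % 8 = 3 →
      ∀ (W : WeierstrassCurve ℚ) [W.IsElliptic] [W.IsGloballyMinimal] (C : VariableChange ℚ),
        C • W = cm7.quadraticTwist (d : ℚ) → W.analyticRank = 1 → Finite W.sha →
      ∀ (K : Type) [Field K] [NumberField K], IsImaginaryQuadratic K →
      ∀ (v vbar : HeightOneSpectrum (𝓞 K)),
        ((2 : ℕ) : 𝓞 K) ∈ v.asIdeal → ((2 : ℕ) : 𝓞 K) ∈ vbar.asIdeal → vbar ≠ v →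
      ∀ (π : (W.baseChange K).endRing), (π : AddMonoid.End (W.baseChange K).geomPoints) * π = π - 2 →
      ∀ (r : ℤ_[2]), r * r = r - 2 →
        (∀ τ ∈ GreenbergSelmer.inertia v, ∀ x : ↥((W.baseChange K).endEigenPrimaryTorsion 2 π r), τ • x = x ∨ τ • x = -x) →
      ∀ (κ' : ZpExtension K 2), κ'.IsUnramifiedOutside vbar → ∀ (γ' : absoluteGaloisGroup K), κ'.IsTopGenerator γ' →
      ∀ (P : W.toAffine.Point) (c₀ : ℕ) (ℓ : ℤ),
        ¬ IsOfFinAddOrder P →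
        (∀ R : W.toAffine.Point, ∃ (k : ℤ) (T : W.toAffine.Point), IsOfFinAddOrder T ∧ R = k • P + T) →
        c₀ ≠ 0 → (W.baseChange ℚ_[2]).IsInReductionKernel (c₀ • W.toPadicPoint 2 P) →
        ‖(W.baseChange ℚ_[2]).padicLogPoint (c₀ • W.toPadicPoint 2 P) / (c₀ : ℚ_[2])‖ = (2 : ℝ) ^ (-ℓ) →
      ∀ (Dnr : GreenbergVatsal2000.DatumDualData κ' γ' ↥((W.baseChange K).endEigenPrimaryTorsion 2 π r)
          (Castella2018.AcSelmer.bdpData ↥((W.baseChange K).endEigenPrimaryTorsion 2 π r) 2 vbar) ∅) (n' : ℕ) (H' : IwasawaAlgebra 2),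
        Module.Finite (IwasawaAlgebra 2) Dnr.X → Module.IsTorsion (IwasawaAlgebra 2) Dnr.X →
        Module.charIdeal (IwasawaAlgebra 2) Dnr.X = Ideal.span {H'} → PowerSeries.constantCoeff H' ≠ 0 →
        (PowerSeries.constantCoeff H').valuation = n' →
      ∃ (D : Agboola2007.RestrictedDualData κ' ↥((W.baseChange K).endEigenPrimaryTorsion 2 π r) vbar γ') (n : ℕ),
        Module.Finite (IwasawaAlgebra 2) D.X ∧ D.HasCharValuationAt n ∧ (n' : ℤ) = n + 2)
    (h07 : ∀ (d : ℤ), d ≠ 0 → Squarefree d → d % 4 ≠ 1 → ((2 : ℤ) ∣ d ∧ (d / 2) % 8 = 7) →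
      ∀ (W : WeierstrassCurve ℚ) [W.IsElliptic] [W.IsGloballyMinimal] (C : VariableChange ℚ),
        C • W = cm7.quadraticTwist (d : ℚ) → W.analyticRank = 1 → Finite W.sha →
      ∀ (K : Type) [Field K] [NumberField K], IsImaginaryQuadratic K →
      ∀ (v vbar : HeightOneSpectrum (𝓞 K)),
        ((2 : ℕ) : 𝓞 K) ∈ v.asIdeal → ((2 : ℕ) : 𝓞 K) ∈ vbar.asIdeal → vbar ≠ v →
      ∀ (π : (W.baseChange K).endRing), (π : AddMonoid.End (W.baseChange K).geomPoints) * π = π - 2 →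
      ∀ (r : ℤ_[2]), r * r = r - 2 →
        (∀ τ ∈ GreenbergSelmer.inertia v, ∀ x : ↥((W.baseChange K).endEigenPrimaryTorsion 2 π r), τ • x = x ∨ τ • x = -x) →
      ∀ (κ' : ZpExtension K 2), κ'.IsUnramifiedOutside vbar → ∀ (γ' : absoluteGaloisGroup K), κ'.IsTopGenerator γ' →
      ∀ (P : W.toAffine.Point) (c₀ : ℕ) (ℓ : ℤ),
        ¬ IsOfFinAddOrder P →
        (∀ R : W.toAffine.Point, ∃ (k : ℤ) (T : W.toAffine.Point), IsOfFinAddOrder T ∧ R = k • P + T) →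
        c₀ ≠ 0 → (W.baseChange ℚ_[2]).IsInReductionKernel (c₀ • W.toPadicPoint 2 P) →
        ‖(W.baseChange ℚ_[2]).padicLogPoint (c₀ • W.toPadicPoint 2 P) / (c₀ : ℚ_[2])‖ = (2 : ℝ) ^ (-ℓ) →
      ∀ (Dnr : GreenbergVatsal2000.DatumDualData κ' γ' ↥((W.baseChange K).endEigenPrimaryTorsion 2 π r)
          (Castella2018.AcSelmer.bdpData ↥((W.baseChange K).endEigenPrimaryTorsion 2 π r) 2 vbar) ∅) (n' : ℕ) (H' : IwasawaAlgebra 2),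
        Module.Finite (IwasawaAlgebra 2) Dnr.X → Module.IsTorsion (IwasawaAlgebra 2) Dnr.X →
        Module.charIdeal (IwasawaAlgebra 2) Dnr.X = Ideal.span {H'} → PowerSeries.constantCoeff H' ≠ 0 →
        (PowerSeries.constantCoeff H').valuation = n' →
      ∃ (D : Agboola2007.RestrictedDualData κ' ↥((W.baseChange K).endEigenPrimaryTorsion 2 π r) vbar γ') (n : ℕ),
        Module.Finite (IwasawaAlgebra 2) D.X ∧ D.HasCharValuationAt n ∧ (n' : ℤ) = n + 1)
    (h15 : ∀ (d : ℤ), d ≠ 0 → Squarefree d → d % 4 ≠ 1 → ((2 : ℤ) ∣ d ∧ (d / 2) % 4 = 1) →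
      ∀ (W : WeierstrassCurve ℚ) [W.IsElliptic] [W.IsGloballyMinimal] (C : VariableChange ℚ),
        C • W = cm7.quadraticTwist (d : ℚ) → W.analyticRank = 1 → Finite W.sha →
      ∀ (K : Type) [Field K] [NumberField K], IsImaginaryQuadratic K →
      ∀ (v vbar : HeightOneSpectrum (𝓞 K)),
        ((2 : ℕ) : 𝓞 K) ∈ v.asIdeal → ((2 : ℕ) : 𝓞 K) ∈ vbar.asIdeal → vbar ≠ v →
      ∀ (π : (W.baseChange K).endRing), (π : AddMonoid.End (W.baseChange K).geomPoints) * π = π - 2 →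
      ∀ (r : ℤ_[2]), r * r = r - 2 →
        (∀ τ ∈ GreenbergSelmer.inertia v, ∀ x : ↥((W.baseChange K).endEigenPrimaryTorsion 2 π r), τ • x = x ∨ τ • x = -x) →
      ∀ (κ' : ZpExtension K 2), κ'.IsUnramifiedOutside vbar → ∀ (γ' : absoluteGaloisGroup K), κ'.IsTopGenerator γ' →
      ∀ (P : W.toAffine.Point) (c₀ : ℕ) (ℓ : ℤ),
        ¬ IsOfFinAddOrder P →
        (∀ R : W.toAffine.Point, ∃ (k : ℤ) (T : W.toAffine.Point), IsOfFinAddOrder T ∧ R = k • P + T) →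
        c₀ ≠ 0 → (W.baseChange ℚ_[2]).IsInReductionKernel (c₀ • W.toPadicPoint 2 P) →
        ‖(W.baseChange ℚ_[2]).padicLogPoint (c₀ • W.toPadicPoint 2 P) / (c₀ : ℚ_[2])‖ = (2 : ℝ) ^ (-ℓ) →
      ∀ (Dnr : GreenbergVatsal2000.DatumDualData κ' γ' ↥((W.baseChange K).endEigenPrimaryTorsion 2 π r)
          (Castella2018.AcSelmer.bdpData ↥((W.baseChange K).endEigenPrimaryTorsion 2 π r) 2 vbar) ∅) (n' : ℕ) (H' : IwasawaAlgebra 2),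
        Module.Finite (IwasawaAlgebra 2) Dnr.X → Module.IsTorsion (IwasawaAlgebra 2) Dnr.X →
        Module.charIdeal (IwasawaAlgebra 2) Dnr.X = Ideal.span {H'} → PowerSeries.constantCoeff H' ≠ 0 →
        (PowerSeries.constantCoeff H').valuation = n' →
      ∃ (D : Agboola2007.RestrictedDualData κ' ↥((W.baseChange K).endEigenPrimaryTorsion 2 π r) vbar γ') (n : ℕ),
        Module.Finite (IwasawaAlgebra 2) D.X ∧ D.HasCharValuationAt n ∧ (n' : ℤ) = n + 0) :
    ∃ eδ : ℤ → ℤ → ℤ,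
    ∀ (d : ℤ), d ≠ 0 → Squarefree d → d % 4 ≠ 1 →
    ∀ (W : WeierstrassCurve ℚ) [W.IsElliptic] [W.IsGloballyMinimal] (C : VariableChange ℚ),
      C • W = cm7.quadraticTwist (d : ℚ) → W.analyticRank = 1 → Finite W.sha →
    ∀ (K : Type) [Field K] [NumberField K], IsImaginaryQuadratic K →
    ∀ (v vbar : HeightOneSpectrum (𝓞 K)),
      ((2 : ℕ) : 𝓞 K) ∈ v.asIdeal → ((2 : ℕ) : 𝓞 K) ∈ vbar.asIdeal → vbar ≠ v →
    ∀ (π : (W.baseChange K).endRing), (π : AddMonoid.End (W.baseChange K).geomPoints) * π = π - 2 →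
    ∀ (r : ℤ_[2]), r * r = r - 2 →
      (∀ τ ∈ GreenbergSelmer.inertia v, ∀ x : ↥((W.baseChange K).endEigenPrimaryTorsion 2 π r), τ • x = x ∨ τ • x = -x) →
    ∀ (κ' : ZpExtension K 2), κ'.IsUnramifiedOutside vbar → ∀ (γ' : absoluteGaloisGroup K), κ'.IsTopGenerator γ' →
    ∀ (P : W.toAffine.Point) (c₀ : ℕ) (ℓ : ℤ),
      ¬ IsOfFinAddOrder P →
      (∀ R : W.toAffine.Point, ∃ (k : ℤ) (T : W.toAffine.Point), IsOfFinAddOrder T ∧ R = k • P + T) →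
      c₀ ≠ 0 → (W.baseChange ℚ_[2]).IsInReductionKernel (c₀ • W.toPadicPoint 2 P) →
      ‖(W.baseChange ℚ_[2]).padicLogPoint (c₀ • W.toPadicPoint 2 P) / (c₀ : ℚ_[2])‖ = (2 : ℝ) ^ (-ℓ) →
    ∀ (Dnr : GreenbergVatsal2000.DatumDualData κ' γ' ↥((W.baseChange K).endEigenPrimaryTorsion 2 π r)
        (Castella2018.AcSelmer.bdpData ↥((W.baseChange K).endEigenPrimaryTorsion 2 π r) 2 vbar) ∅) (n' : ℕ) (H' : IwasawaAlgebra 2),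
      Module.Finite (IwasawaAlgebra 2) Dnr.X → Module.IsTorsion (IwasawaAlgebra 2) Dnr.X →
      Module.charIdeal (IwasawaAlgebra 2) Dnr.X = Ideal.span {H'} → PowerSeries.constantCoeff H' ≠ 0 →
      (PowerSeries.constantCoeff H').valuation = n' →
    ∃ (D : Agboola2007.RestrictedDualData κ' ↥((W.baseChange K).endEigenPrimaryTorsion 2 π r) vbar γ') (n : ℕ),
      Module.Finite (IwasawaAlgebra 2) D.X ∧ D.HasCharValuationAt n ∧
      (n' : ℤ) = n + eδ (d % 2) ((d / (2 - d % 2)) % 8) := by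
  refine ⟨fun k₁ k₂ ↦ if k₁ = 1 ∧ k₂ = 3 then 2 else if k₁ = 0 ∧ k₂ = 7 then 1 else 0, ?_⟩
  intro d hd0 hsq hd4 W _ _ C hC hrank hsha K _ _ hK v vbar hv hvbar hne π hπ r hr hpin κ' hκ' γ' hγ' P c₀ ℓ hP hgen hc₀ hker hlog
    Dnr n' H' hfin htors hch hH0 hn'
  -- the six keys: odd `d` has `d % 8 ∈ {3, 7}`; even square-free `d` has odd `d / 2`
  rcases Int.emod_two_eq_zero_or_one d with heven | hodd
  · -- even: key `(0, (d/2) % 8)`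
    have h2d : (2 : ℤ) ∣ d := Int.dvd_of_emod_eq_zero heven
    have hhalf := emod_two_ediv_two_of_squarefree hsq h2d
    have hkey : ((fun k₁ k₂ : ℤ ↦ if k₁ = 1 ∧ k₂ = 3 then (2 : ℤ) else if k₁ = 0 ∧ k₂ = 7 then 1 else 0) (d % 2) ((d / (2 - d % 2)) % 8)) =
        (if (d / 2) % 8 = 7 then 1 else 0) := by
      rw [heven]; norm_num
    rcases (show (d / 2) % 8 = 1 ∨ (d / 2) % 8 = 3 ∨ (d / 2) % 8 = 5 ∨ (d / 2) % 8 = 7 by omega) with h1 | h3 | h5 | h7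
    · obtain ⟨D, n, hDf, hDn, he⟩ := h15 d hd0 hsq hd4 ⟨h2d, by omega⟩ W C hC hrank hsha K hK v vbar hv hvbar hne π hπ r hr hpin κ' hκ' γ' hγ'
        P c₀ ℓ hP hgen hc₀ hker hlog Dnr n' H' hfin htors hch hH0 hn'
      exact ⟨D, n, hDf, hDn, by rw [hkey, if_neg (by omega), he]⟩
    · obtain ⟨D, n, hDf, hDn, he⟩ := strictDefectAtVbar_two_of_frame_classTwo d hd0 hsq hd4 (Or.inr ⟨h2d, h3⟩) W C hC hrank hsha K hK v vbar hv hvbar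
        hne π hπ r hr hpin κ' hκ' γ' hγ' P c₀ ℓ hP hgen hc₀ hker hlog Dnr n' H' hfin htors hch hH0 hn'
      exact ⟨D, n, hDf, hDn, by rw [hkey, if_neg (by omega), he]⟩
    · obtain ⟨D, n, hDf, hDn, he⟩ := h15 d hd0 hsq hd4 ⟨h2d, by omega⟩ W C hC hrank hsha K hK v vbar hv hvbar hne π hπ r hr hpin κ' hκ' γ' hγ'
        P c₀ ℓ hP hgen hc₀ hker hlog Dnr n' H' hfin htors hch hH0 hn'
      exact ⟨D, n, hDf, hDn, by rw [hkey, if_neg (by omega), he]⟩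
    · obtain ⟨D, n, hDf, hDn, he⟩ := h07 d hd0 hsq hd4 ⟨h2d, h7⟩ W C hC hrank hsha K hK v vbar hv hvbar hne π hπ r hr hpin κ' hκ' γ' hγ'
        P c₀ ℓ hP hgen hc₀ hker hlog Dnr n' H' hfin htors hch hH0 hn'
      exact ⟨D, n, hDf, hDn, by rw [hkey, if_pos h7, he]⟩
  · -- odd: key `(1, d % 8)` with `d % 8 ∈ {3, 7}` (`d % 4 ≠ 1`)
    have hkey : ((fun k₁ k₂ : ℤ ↦ if k₁ = 1 ∧ k₂ = 3 then (2 : ℤ) else if k₁ = 0 ∧ k₂ = 7 then 1 else 0) (d % 2) ((d / (2 - d % 2)) % 8)) =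
        (if d % 8 = 3 then 2 else 0) := by
      rw [hodd]; norm_num
    rcases (show d % 8 = 3 ∨ d % 8 = 7 by omega) with h3 | h7
    · obtain ⟨D, n, hDf, hDn, he⟩ := h13 d hd0 hsq hd4 h3 W C hC hrank hsha K hK v vbar hv hvbar hne π hπ r hr hpin κ' hκ' γ' hγ'
        P c₀ ℓ hP hgen hc₀ hker hlog Dnr n' H' hfin htors hch hH0 hn'
      exact ⟨D, n, hDf, hDn, by rw [hkey, if_pos h3, he]⟩
    · obtain ⟨D, n, hDf, hDn, he⟩ := strictDefectAtVbar_two_of_frame_classTwo d hd0 hsq hd4 (Or.inl h7) W C hC hrank hsha K hK v vbar hv hvbar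
        hne π hπ r hr hpin κ' hκ' γ' hγ' P c₀ ℓ hP hgen hc₀ hker hlog Dnr n' H' hfin htors hch hH0 hn'
      exact ⟨D, n, hDf, hDn, by rw [hkey, if_neg (by omega), he]⟩

end Summit.BirchSwinnertonDyer.BirchSwinnertonDyer.Theorems.PrintCf2.StrictDefect

end
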